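import Mathlib.Combinatorics.SimpleGraph.Metric
import Summits.CriticalPhenomena.SAWScalingLimit.Theorems.SAWTotalPositivityBoundaryTP2Defs
import HarnessLib

/-!
# Crux `BoundaryTP2` (stmt-CriticalPhenomena-7115): the four-point condition of interlaced quadruples

The leading order in the fugacity `x` of the crux's inequality `Z(p₁,p₃)Z(p₂,p₄) ≤ Z(p₁,p₂)Z(p₃,p₄)`
(`Z = pathKernel H x`) is governed by graph distances: `Z(a,b) = N(a,b)·x^{d(a,b)} + O(x^{d(a,b)+1})`.
This file proves, for EVERY simple graph (no planarity, no lattice), that interlacing alone forces the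
metric four-point condition

  `d(p₁,p₂) + d(p₃,p₄) ≤ d(p₁,p₃) + d(p₂,p₄)`  and  `d(p₁,p₄) + d(p₂,p₃) ≤ d(p₁,p₃) + d(p₂,p₄)`,

i.e. the crossing pairing is never SHORTER than either nested pairing, so `Z(p₁,p₃)Z(p₂,p₄)` never starts
at a lower power of `x` than `Z(p₁,p₂)Z(p₃,p₄)` (lead c3, analysis note F1 §4: the conjecture's content
lies entirely in the `x_c`-dependent tail; the census of the refuters' LEX test is the coefficient version).
Proof: two geodesics `p₁ → p₃`, `p₂ → p₄` meet at a vertex `w` (interlacing); re-pairing the four half-geodesics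
at `w` gives walks `p₁ → w → p₂` and `p₃ → w → p₄` of the same total length. Stated in `ℕ∞` (`SimpleGraph.edist`)
so that no reachability hypothesis is needed, with the `ℕ`-valued `SimpleGraph.dist` corollary. [folklore]
-/

namespace Summit.CriticalPhenomena.SAWScalingLimit.Theorems.BoundaryTP2

open SimpleGraph

variable {V : Type*} {H : SimpleGraph V} {p₁ p₂ p₃ p₄ : V}

/-- Re-pairing two walks at a common vertex: if `w` lies on a walk `P : a → c` and on a walk `Q : b → d`,
then `edist a b + edist c d ≤ |P| + |Q|`. [folklore] -/
theorem edist_add_edist_le_length_add_length {a b c d w : V} (P : H.Walk a c) (Q : H.Walk b d)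
    (hP : w ∈ P.support) (hQ : w ∈ Q.support) :
    H.edist a b + H.edist c d ≤ (P.length : ℕ∞) + (Q.length : ℕ∞) := by
  classical
  have h₁ : H.edist a b ≤ ((P.takeUntil w hP).length : ℕ∞) + ((Q.takeUntil w hQ).length : ℕ∞) := by
    have := edist_le ((P.takeUntil w hP).append (Q.takeUntil w hQ).reverse)
    simpa only [Walk.length_append, Walk.length_reverse, Nat.cast_add] using this
  have h₂ : H.edist c d ≤ ((P.dropUntil w hP).length : ℕ∞) + ((Q.dropUntil w hQ).length : ℕ∞) := by
    have := edist_le ((P.dropUntil w hP).reverse.append (Q.dropUntil w hQ))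
    simpa only [Walk.length_append, Walk.length_reverse, Nat.cast_add] using this
  have hPl : ((P.takeUntil w hP).length : ℕ∞) + ((P.dropUntil w hP).length : ℕ∞) = P.length := by
    rw [← Nat.cast_add, ← Walk.length_append, Walk.take_spec]
  have hQl : ((Q.takeUntil w hQ).length : ℕ∞) + ((Q.dropUntil w hQ).length : ℕ∞) = Q.length := by
    rw [← Nat.cast_add, ← Walk.length_append, Walk.take_spec]
  calc H.edist a b + H.edist c d
      ≤ (((P.takeUntil w hP).length : ℕ∞) + ((Q.takeUntil w hQ).length : ℕ∞)) +
          (((P.dropUntil w hP).length : ℕ∞) + ((Q.dropUntil w hQ).length : ℕ∞)) := add_le_add h₁ h₂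
    _ = (P.length : ℕ∞) + (Q.length : ℕ∞) := by rw [← hPl, ← hQl]; ring

/-- **Four-point condition of an interlaced quadruple** (extended distances, any simple graph): if every
self-avoiding path `p₁ → p₃` meets every self-avoiding path `p₂ → p₄`, then
`edist p₁ p₂ + edist p₃ p₄ ≤ edist p₁ p₃ + edist p₂ p₄` — the nested pairing `(p₁p₂|p₃p₄)` is never longer
than the crossing one. This is the leading `x`-order of the TP₂ inequality of the crux. [folklore] -/
theorem interlaced_edist_add_edist_le (hI : Interlaced H p₁ p₂ p₃ p₄) :
    H.edist p₁ p₂ + H.edist p₃ p₄ ≤ H.edist p₁ p₃ + H.edist p₂ p₄ := by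
  by_cases h₁₃ : H.Reachable p₁ p₃
  · by_cases h₂₄ : H.Reachable p₂ p₄
    · obtain ⟨P, hPp, hPlen⟩ := h₁₃.exists_path_of_dist
      obtain ⟨Q, hQp, hQlen⟩ := h₂₄.exists_path_of_dist
      obtain ⟨w, hwP, hwQ⟩ := hI ⟨P, hPp⟩ ⟨Q, hQp⟩
      have := edist_add_edist_le_length_add_length P Q hwP hwQ
      rwa [hPlen, hQlen, h₁₃.coe_dist_eq_edist, h₂₄.coe_dist_eq_edist] at this
    · rw [edist_eq_top_of_not_reachable h₂₄, add_top]; exact le_top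
  · rw [edist_eq_top_of_not_reachable h₁₃, top_add]; exact le_top

/-- The other nested pairing: interlacing also gives `edist p₁ p₄ + edist p₂ p₃ ≤ edist p₁ p₃ + edist p₂ p₄`
(re-pair the half-geodesics the other way at the common vertex). [folklore] -/
theorem interlaced_edist_add_edist_le' (hI : Interlaced H p₁ p₂ p₃ p₄) :
    H.edist p₁ p₄ + H.edist p₂ p₃ ≤ H.edist p₁ p₃ + H.edist p₂ p₄ := by
  by_cases h₁₃ : H.Reachable p₁ p₃
  · by_cases h₂₄ : H.Reachable p₂ p₄
    · obtain ⟨P, hPp, hPlen⟩ := h₁₃.exists_path_of_dist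
      obtain ⟨Q, hQp, hQlen⟩ := h₂₄.exists_path_of_dist
      obtain ⟨w, hwP, hwQ⟩ := hI ⟨P, hPp⟩ ⟨Q, hQp⟩
      have hwQ' : w ∈ Q.reverse.support := by rw [Walk.support_reverse]; exact List.mem_reverse.2 hwQ
      have := edist_add_edist_le_length_add_length P Q.reverse hwP hwQ'
      rw [Walk.length_reverse, hPlen, hQlen, h₁₃.coe_dist_eq_edist, h₂₄.coe_dist_eq_edist] at this
      rwa [edist_comm (u := p₂) (v := p₃)]
    · rw [edist_eq_top_of_not_reachable h₂₄, add_top]; exact le_top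
  · rw [edist_eq_top_of_not_reachable h₁₃, top_add]; exact le_top

/-- `ℕ`-valued form: for an interlaced quadruple with `p₁ ⇝ p₃` and `p₂ ⇝ p₄` reachable,
`dist p₁ p₂ + dist p₃ p₄ ≤ dist p₁ p₃ + dist p₂ p₄`. [folklore] -/
theorem interlaced_dist_add_dist_le (hI : Interlaced H p₁ p₂ p₃ p₄) (h₁₃ : H.Reachable p₁ p₃)
    (h₂₄ : H.Reachable p₂ p₄) :
    H.dist p₁ p₂ + H.dist p₃ p₄ ≤ H.dist p₁ p₃ + H.dist p₂ p₄ := by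
  classical
  obtain ⟨P, hPp, hPlen⟩ := h₁₃.exists_path_of_dist
  obtain ⟨Q, hQp, hQlen⟩ := h₂₄.exists_path_of_dist
  obtain ⟨w, hwP, hwQ⟩ := hI ⟨P, hPp⟩ ⟨Q, hQp⟩
  have h₁ : H.dist p₁ p₂ ≤ (P.takeUntil w hwP).length + (Q.takeUntil w hwQ).length := by
    have := dist_le ((P.takeUntil w hwP).append (Q.takeUntil w hwQ).reverse)
    simpa only [Walk.length_append, Walk.length_reverse] using this
  have h₂ : H.dist p₃ p₄ ≤ (P.dropUntil w hwP).length + (Q.dropUntil w hwQ).length := by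
    have := dist_le ((P.dropUntil w hwP).reverse.append (Q.dropUntil w hwQ))
    simpa only [Walk.length_append, Walk.length_reverse] using this
  have hPl : (P.takeUntil w hwP).length + (P.dropUntil w hwP).length = P.length := by
    rw [← Walk.length_append, Walk.take_spec]
  have hQl : (Q.takeUntil w hwQ).length + (Q.dropUntil w hwQ).length = Q.length := by
    rw [← Walk.length_append, Walk.take_spec]
  omega

end Summit.CriticalPhenomena.SAWScalingLimit.Theorems.BoundaryTP2
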